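/-
Copyright (c) 2026 the pub-hodgecm-mathlib formalisation cell (harness21).  Prover seat hodgecm-mathlib-K2E3-p11 (g7), Track B «K2-LIT» ∕ h413
(`stmt-HodgeConjecture-24833`), leaf (nsc-S-A′) «principal-block standard span», case brick C2 «cube» (architect K2E3-p25 (g2) `MEMO-SA-architecture.v2` §3,
dealer K2E3-plan (g4)), file C2b-gen: ABSTRACT EXPONENT-CLASS TOOLS (no cube, no H0).  2026-09-04.
-/
import Summits.HodgeConjecture.HodgeConjecture.Theorems.K2E3GL3WeightOneUniqueness        -- ★ UNIQ (K2E3-p23): `finrank_weightSpace_add_le_of_inf_eq_bot`; brings ★ ADD ∕ EMB ∕ H0-a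
import Summits.HodgeConjecture.HodgeConjecture.Theorems.K2E3GL3PrincipalSeriesExhaustion    -- ★ EXH (K2E3-p23): `exists_finrank_weightSpace_ne_zero_of_constituents`, `…_quotientRep_ne_zero`
import Literature.NumberTheory.Automorphic.SmoothCharacterAdditive                          -- ★ `Representation.smoothTrace_eq_add_of_subrepresentation`
import Literature.NumberTheory.Automorphic.AdmissibleSubquotient                            -- ★ `IsSmooth.toRepresentation ∕ of_surjective`, `IsAdmissible.toRepresentation ∕ quotientRep`
import Literature.NumberTheory.Automorphic.JacquetGLFunctor                                 -- ★ `IntertwiningMap.codRestrictSubrep`, `IntertwiningMap.rangeInverse`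
import HarnessLib

/-!
# K2_E3 road (h413), leaf (nsc-S-A′), case brick C2 «cube», file C2b-gen — abstract exponent-class tools

Cell `pub/hodgecm-mathlib` (D-0151), Track B, seat K2E3-p11 (g7); architecture K2E3-p25 (g2) `MEMO-SA-architecture.v2` §3 (case bricks), C2 PLAN v1 (K2 bus
2026-09-04 11:36Z).  `--supports stmt-HodgeConjecture-24833 --as helper`; THEOREMS ONLY (no definition ∕ instance ∕ notation ∕ named fact ∕ `sorry`); COUNT-NEUTRAL.

Everything here is ABSTRACT: `V` a smooth representation of `GL_n(F)` on `X : Type` with finite-dimensional Borel Jacquet module `r_B V`,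
`mult V η := dim (r_B V)_η` the generalised-weight multiplicity of `η : T → ℂ` (spelled out: `finrank ℂ ↥(⨅ m, maxGenEigenspace (normalizedJacquetGL F id V m) (η m))`),
and the EXH hypothesis `hJ` «every irreducible constituent of `V` has `r_B ≠ 0`» (★ E4a discharges it for principal series and — by ★ `IsConstituentOf.of_injective ∕
of_surjective` — for everything embedded in or covered by one).  The case bricks C2b∕C2 (`K2E3GL3CubeConstituents`, `K2E3GL3Cube`) only instantiate these.

THE MATHEMATICS (Bernstein–Zelevinsky exponent bookkeeping [BernsteinZelevinsky1977, §2.3, Cor. 2.13, Thm. 2.9]; [Casselman1995, §6.3]; [Zelevinsky1980, §1]):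
* §1 plumbing: an intertwining map `Ψ : ρ → τ` whose range lies in the range of an INJECTIVE `Φ : σ → τ` factors as `Φ ∘ Λ` (`Λ := Φ⁻¹ ∘ Ψ`); `ρ ≅ range Φ` for `Φ`
  injective; the first isomorphism theorem `P ⁄ ker(Ψ|_P) ≅ S` for `P = Ψ⁻¹(S)`, `S ≤ range Ψ`, as a `Representation.Equiv`; `mult` decreases along injective and
  along surjective intertwining maps (★ ADD monotonicity + `Equiv`-invariance).
* §2 the ZERO representation: a representation on a `Subsingleton` space has character `0`; conversely `mult V η = 0` for all `η` (with `hJ`) forces `X` subsingleton (★ EXH).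
* §3 IRREDUCIBILITY BY EXPONENTS: (I1) a single weight of multiplicity `≤ 1` ⇒ `V` irreducible; (I2) exactly two weights `η₁, η₂` of multiplicity one, with the
  CLASS CONSTANCY `mult N η₁ = mult N η₂` for every subrepresentation `N` (this is what H0's swap rules give), ⇒ `V` irreducible — a proper non-zero `N` and `V⁄N` would
  both need a weight (★ EXH) and split the class.
* §4 the SOCLE ARGUMENT: an irreducible subrepresentation `N ≤ V` carrying a weight `η` with `mult V η ≤ 1` lies inside every subrepresentation `M` carrying `η`
  (else `N ⊓ M = ⊥` and ★ UNIQ ED. 2 pigeonhole gives `mult N η + mult M η ≤ mult V η ≤ 1`).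
HONEST LABEL: HC_CM is proved only modulo the 7 printed citations (2 remaining named inputs: hLiu418 = stmt-HodgeConjecture-24832, h413 = stmt-HodgeConjecture-24833)
until rung 0 closes; count-neutral helper (representation theory of `GL_n(F)`; no printed citation is discharged).

## Mathlib ∕ tree search
Tree ★: ADD `finrank_weightSpace_eq_add_subrepresentation ∕ _subrepresentation_le ∕ _quotientRep_le ∕ _eq_of_equiv`, `finiteDimensional_jacquet_subrepresentation ∕ _quotientRep ∕ _of_equiv` ·
EXH `exists_finrank_weightSpace_ne_zero_of_constituents ∕ _quotientRep_ne_zero` · UNIQ ED. 2 `finrank_weightSpace_add_le_of_inf_eq_bot` · `IsConstituentOf.of_subrepresentation ∕ of_injective ∕ of_surjective` ·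
`IntertwiningMap.codRestrictSubrep ∕ rangeInverse ∕ apply_rangeInverse` · `IsSmooth.toRepresentation ∕ of_surjective` · `Representation.smoothTrace`, `levelTrace_def` · `IrrClass.nontrivial_of_isIrreducible`.
Mathlib: `Representation.IntertwiningMap.range ∕ ker ∕ ofBijective`, `Representation.Equiv.mk`, `LinearMap.quotKerEquivOfSurjective`, `Submodule.quotEquivOfEq`, `IsSimpleOrder`.
Dedup: `rg "ExponentClassTools|isIrreducible_of_finrank_weightSpace|smoothTrace_eq_zero_of_subsingleton|le_of_isIrreducible_of_finrank"` — none.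

## References
* [BernsteinZelevinsky1977] I. N. Bernstein, A. V. Zelevinsky, *Induced representations of reductive p-adic groups I*, Ann. Sci. ÉNS 10 (1977), §2.3, Cor. 2.13, Thm. 2.9.
* [Casselman1995] W. Casselman, *Introduction to the theory of admissible representations of p-adic reductive groups* (1995 notes), §6.3.
* [Zelevinsky1980] A. V. Zelevinsky, *Induced representations of reductive p-adic groups II*, Ann. Sci. ÉNS 13 (1980), §1.
-/

set_option autoImplicit false
-- the mandated namespace repeats the single-problem summit's segment (`HodgeConjecture.HodgeConjecture`)
set_option linter.dupNamespace false

noncomputable section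

open Module Function MeasureTheory
open scoped MatrixGroups
open Literature.NumberTheory.Automorphic ValuativeRel Representation
open Literature.NumberTheory.GaloisRepresentations Literature.NumberTheory.GaloisRepresentations.IsNonarchimedeanLocalField
open Literature.RepresentationTheory.FiniteGroups Literature.RepresentationTheory.Semisimple
open Summit.HodgeConjecture.HodgeConjecture.Cruxes.H413.K2E3GL3JacquetMultiplicityAdditive
open Summit.HodgeConjecture.HodgeConjecture.Cruxes.H413.K2E3GL3WeightOneUniqueness
open Summit.HodgeConjecture.HodgeConjecture.Cruxes.H413.K2E3GL3PrincipalSeriesExhaustion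

namespace Summit.HodgeConjecture.HodgeConjecture.Cruxes.H413.K2E3GL3ExponentClassTools

/-! ## §1 Plumbing: factoring through an injective map, `ρ ≅ range Φ`, the first isomorphism theorem, monotonicity of `mult` along maps -/

section Plumbing

variable {G : Type*} [Group G] {V₁ V₂ V₃ : Type*} [AddCommGroup V₁] [Module ℂ V₁] [AddCommGroup V₂] [Module ℂ V₂] [AddCommGroup V₃] [Module ℂ V₃]
  {ρ : Representation ℂ G V₁} {σ : Representation ℂ G V₂} {τ : Representation ℂ G V₃}

/-- **Factoring through an injective intertwining map.**  If `Φ : σ → τ` is injective and `range Ψ ≤ range Φ` for `Ψ : ρ → τ`, then `Ψ = Φ ∘ Λ` for an intertwining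
map `Λ : ρ → σ` (namely `Λ = Φ⁻¹ ∘ Ψ`, ★ `rangeInverse`), injective when `Ψ` is. [folklore] [cite: BernsteinZelevinsky1977, §2.3] -/
theorem exists_intertwiningMap_comp_eq_of_range_le (Φ : σ.IntertwiningMap τ) (hΦ : Function.Injective Φ) (Ψ : ρ.IntertwiningMap τ) (h : Ψ.range ≤ Φ.range) :
    ∃ Λ : ρ.IntertwiningMap σ, ∀ v, Φ (Λ v) = Ψ v := by
  refine ⟨(Φ.rangeInverse hΦ).comp (Ψ.codRestrictSubrep Φ.range fun v => h ⟨v, rfl⟩), fun v => ?_⟩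
  rw [Representation.IntertwiningMap.comp_apply, Representation.IntertwiningMap.apply_rangeInverse]
  rfl

/-- Injective version of `exists_intertwiningMap_comp_eq_of_range_le`. [folklore] [cite: BernsteinZelevinsky1977, §2.3] -/
theorem exists_injective_intertwiningMap_comp_eq_of_range_le (Φ : σ.IntertwiningMap τ) (hΦ : Function.Injective Φ) (Ψ : ρ.IntertwiningMap τ) (hΨ : Function.Injective Ψ)
    (h : Ψ.range ≤ Φ.range) : ∃ Λ : ρ.IntertwiningMap σ, Function.Injective Λ ∧ ∀ v, Φ (Λ v) = Ψ v := by
  obtain ⟨Λ, hΛ⟩ := exists_intertwiningMap_comp_eq_of_range_le Φ hΦ Ψ h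
  exact ⟨Λ, fun a b hab => hΨ (by rw [← hΛ a, ← hΛ b, hab]), hΛ⟩

/-- **`ρ ≅ range Φ`** for an injective intertwining map `Φ : ρ → σ`. [folklore] [cite: BernsteinZelevinsky1977, §2.3] -/
theorem nonempty_equiv_range (Φ : ρ.IntertwiningMap σ) (hΦ : Function.Injective Φ) : Nonempty (ρ.Equiv Φ.range.toRepresentation) :=
  ⟨Representation.IntertwiningMap.ofBijective (Φ.codRestrictSubrep Φ.range fun v => ⟨v, rfl⟩)
    ⟨fun a b hab => hΦ (congrArg Subtype.val hab), fun w => by obtain ⟨v, hv⟩ := w.2; exact ⟨v, Subtype.ext hv⟩⟩⟩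

/-- The range of an injective intertwining map out of an IRREDUCIBLE representation is irreducible (transport along `ρ ≅ range Φ`). [folklore] -/
theorem isIrreducible_range (Φ : ρ.IntertwiningMap σ) (hΦ : Function.Injective Φ) [ρ.IsIrreducible] : Φ.range.toRepresentation.IsIrreducible := by
  obtain ⟨e⟩ := nonempty_equiv_range Φ hΦ
  exact e.isIrreducible

/-- The range of `Φ ∘ Λ` lies in the range of `Φ`: if `Φ (Λ v) = Ψ v` for all `v` then `range Ψ ≤ range Φ`, with equality of the two images `range Ψ = Φ(range Λ)`
read as `(range Ψ).comap Φ … ` — here only the membership form consumed below. [folklore] -/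
theorem mem_range_of_comp_eq (Φ : σ.IntertwiningMap τ) (Λ : ρ.IntertwiningMap σ) (Ψ : ρ.IntertwiningMap τ) (hΛ : ∀ v, Φ (Λ v) = Ψ v) (w : V₂) (hw : w ∈ Λ.range) :
    Φ w ∈ Ψ.range := by
  obtain ⟨v, rfl⟩ := hw
  exact ⟨v, (hΛ v).symm⟩

/-- **First isomorphism theorem, subquotient form.**  For `Ψ : ρ → τ`, a subrepresentation `S ≤ range Ψ` and its pull-back `P = Ψ⁻¹(S)`, the quotient of `P` by the
kernel of `Ψ|_P` is equivalent to `S`. [folklore] [cite: BernsteinZelevinsky1977, §2.3] -/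
theorem nonempty_equiv_quotientRep_ker (Ψ : ρ.IntertwiningMap τ) (S : Subrepresentation τ) (hS : S ≤ Ψ.range) (P : Subrepresentation ρ)
    (hP : P.toSubmodule = S.toSubmodule.comap Ψ.toLinearMap) :
    Nonempty ((Ψ.comp (Subrepresentation.subtypeIntertwiningMap P)).ker.quotientRep.Equiv S.toRepresentation) := by
  -- `f := Ψ|_P : P → S`, surjective, with kernel `ker (Ψ|_P)`
  have hmem : ∀ p : ↥P.toSubmodule, (Ψ.comp (Subrepresentation.subtypeIntertwiningMap P)) p ∈ S := fun p => hP.le p.2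
  let f := (Ψ.comp (Subrepresentation.subtypeIntertwiningMap P)).codRestrictSubrep S hmem
  have hf : Function.Surjective f := by
    rintro ⟨w, hw⟩
    obtain ⟨v, hv⟩ := hS hw
    have hvP : v ∈ P.toSubmodule := hP.ge (show Ψ.toLinearMap v ∈ S.toSubmodule by rw [hv]; exact hw)
    exact ⟨⟨v, hvP⟩, Subtype.ext hv⟩
  have hker : (Ψ.comp (Subrepresentation.subtypeIntertwiningMap P)).ker.toSubmodule = LinearMap.ker f.toLinearMap := by
    ext p
    change (Ψ.comp (Subrepresentation.subtypeIntertwiningMap P)) p = 0 ↔ f p = 0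
    exact ⟨fun h => Subtype.ext h, fun h => congrArg Subtype.val h⟩
  let χ : (↥P.toSubmodule ⧸ (Ψ.comp (Subrepresentation.subtypeIntertwiningMap P)).ker.toSubmodule) ≃ₗ[ℂ] ↥S.toSubmodule :=
    (Submodule.quotEquivOfEq _ _ hker).trans (LinearMap.quotKerEquivOfSurjective f.toLinearMap hf)
  have hχ : ∀ p : ↥P.toSubmodule, χ (Submodule.Quotient.mk p) = f p := fun p => by
    simp only [χ, LinearEquiv.trans_apply, Submodule.quotEquivOfEq_mk, LinearMap.quotKerEquivOfSurjective_apply_mk]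
    rfl
  refine ⟨Representation.Equiv.mk χ fun g => Submodule.linearMap_qext _ (LinearMap.ext fun p => ?_)⟩
  simp only [LinearMap.coe_comp, LinearEquiv.coe_coe, Function.comp_apply, Submodule.mkQ_apply, Subrepresentation.quotientRep_mk, hχ]
  exact Representation.IntertwiningMap.isIntertwining _ _ f g p

end Plumbing

section Monotone

variable {F : Type} [Field F] [ValuativeRel F] [TopologicalSpace F] [IsNonarchimedeanLocalField F] {n : ℕ}
  {X Y : Type} [AddCommGroup X] [Module ℂ X] [AddCommGroup Y] [Module ℂ Y]
  (V : Representation ℂ (GL (Fin n) F) X) (W : Representation ℂ (GL (Fin n) F) Y)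

/-- **`mult` decreases along injective intertwining maps**: `W ↪ V` ⇒ `mult W η ≤ mult V η` (★ ADD: `W ≅ range`, a subrepresentation of `V`).
[cite: BernsteinZelevinsky1977, §2.3] -/
theorem finrank_weightSpace_le_of_injective (hV : V.IsSmooth) [FiniteDimensional ℂ (restrictUnipotentGL F (id : Fin n → Fin n) V).Coinvariants]
    (Φ : W.IntertwiningMap V) (hΦ : Function.Injective Φ) (η : (Π a : Fin n, GL {i : Fin n // (id : Fin n → Fin n) i = a} F) → ℂ) :
    finrank ℂ ↥(⨅ m, Module.End.maxGenEigenspace (normalizedJacquetGL F (id : Fin n → Fin n) W m) (η m)) ≤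
      finrank ℂ ↥(⨅ m, Module.End.maxGenEigenspace (normalizedJacquetGL F (id : Fin n → Fin n) V m) (η m)) := by
  obtain ⟨e⟩ := nonempty_equiv_range Φ hΦ
  rw [finrank_weightSpace_eq_of_equiv _ _ e η]
  exact finrank_weightSpace_subrepresentation_le V hV Φ.range η

/-- **`mult` decreases along surjective intertwining maps**: `V ↠ W` ⇒ `mult W η ≤ mult V η` (★ ADD: `W ≅ V ⁄ ker`, a quotient of `V`). [cite: BernsteinZelevinsky1977, §2.3] -/
theorem finrank_weightSpace_le_of_surjective (hV : V.IsSmooth) [FiniteDimensional ℂ (restrictUnipotentGL F (id : Fin n → Fin n) V).Coinvariants]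
    (Ψ : V.IntertwiningMap W) (hΨ : Function.Surjective Ψ) (η : (Π a : Fin n, GL {i : Fin n // (id : Fin n → Fin n) i = a} F) → ℂ) :
    finrank ℂ ↥(⨅ m, Module.End.maxGenEigenspace (normalizedJacquetGL F (id : Fin n → Fin n) W m) (η m)) ≤
      finrank ℂ ↥(⨅ m, Module.End.maxGenEigenspace (normalizedJacquetGL F (id : Fin n → Fin n) V m) (η m)) := by
  -- `W = Ψ(⊤)`; `⊤ ⁄ ker (Ψ|_⊤) ≅ ⊤_W`, and `W ≅ ⊤_W`
  have htop : (⊤ : Subrepresentation W) ≤ Ψ.range := fun w _ => hΨ w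
  obtain ⟨e⟩ := nonempty_equiv_quotientRep_ker Ψ ⊤ htop ⊤ (Submodule.ext fun _ => ⟨fun _ => trivial, fun _ => trivial⟩)
  have e' : W.Equiv (⊤ : Subrepresentation W).toRepresentation :=
    Representation.Equiv.mk (LinearEquiv.ofTop (⊤ : Subrepresentation W).toSubmodule rfl).symm fun g => LinearMap.ext fun _ => rfl
  have hVs : (⊤ : Subrepresentation V).toRepresentation.IsSmooth := hV.toRepresentation ⊤
  haveI : FiniteDimensional ℂ (restrictUnipotentGL F (id : Fin n → Fin n) (⊤ : Subrepresentation V).toRepresentation).Coinvariants :=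
    finiteDimensional_jacquet_subrepresentation V monotone_id hV ⊤
  rw [finrank_weightSpace_eq_of_equiv _ _ e' η, ← finrank_weightSpace_eq_of_equiv _ _ e η]
  exact (finrank_weightSpace_quotientRep_le _ hVs _ η).trans (finrank_weightSpace_subrepresentation_le V hV ⊤ η)

end Monotone

/-! ## §2 The zero representation: character `0`, and «no weight ⇒ zero» -/

section Zero

/-- **A representation on a trivial space has character `0`** (every `V^K = 0`, so every level trace `Θ_K ≡ 0`). [cite: BernsteinZelevinsky1977, §2.3] -/
theorem smoothTrace_eq_zero_of_subsingleton {G : Type*} [Group G] [TopologicalSpace G] [IsTopologicalGroup G] [MeasurableSpace G] [BorelSpace G]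
    {X : Type*} [AddCommGroup X] [Module ℂ X] [Subsingleton X] (ρ : Representation ℂ G X) (μ : Measure G) [IsFiniteMeasureOnCompacts μ] (f : G → ℂ) :
    ρ.smoothTrace μ f = 0 := by
  by_cases h : HasCompactSupport f ∧ ∃ K : Subgroup G, IsLevel K f
  · rw [Representation.smoothTrace, dif_pos h]
    have h0 : ∀ g, ρ.levelTrace h.2.choose_spec.isOpen h.2.choose_spec.isCompact g = 0 := fun g => by
      rw [Representation.levelTrace_def, Subsingleton.elim (ρ.levelOp h.2.choose_spec.isOpen h.2.choose_spec.isCompact g) 0, map_zero]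
    simp_rw [h0, mul_zero, integral_zero]
  · exact ρ.smoothTrace_of_not μ h

variable {F : Type} [Field F] [ValuativeRel F] [TopologicalSpace F] [IsNonarchimedeanLocalField F] {n : ℕ}
  {X : Type} [AddCommGroup X] [Module ℂ X] (V : Representation ℂ (GL (Fin n) F) X)

/-- **No weight ⇒ zero**: if every irreducible constituent of `V` has `r_B ≠ 0` (`hJ`) and `mult V η = 0` for ALL `η`, then the space of `V` is trivial (★ EXH: a non-trivial
such `V` has a weight). [cite: BernsteinZelevinsky1977, Thm. 2.9, §2.3] -/
theorem subsingleton_of_forall_finrank_weightSpace_eq_zero (hV : V.IsSmooth) [FiniteDimensional ℂ (restrictUnipotentGL F (id : Fin n → Fin n) V).Coinvariants]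
    (hJ : ∀ r : SmoothIrrep (GL (Fin n) F), (IrrClass.mk r).IsConstituentOf V → Nontrivial (restrictUnipotentGL F (id : Fin n → Fin n) r.ρ).Coinvariants)
    (h : ∀ η : (Π a : Fin n, GL {i : Fin n // (id : Fin n → Fin n) i = a} F) → ℂ, finrank ℂ ↥(⨅ m, Module.End.maxGenEigenspace (normalizedJacquetGL F (id : Fin n → Fin n) V m) (η m)) = 0) :
    Subsingleton X := by
  by_contra hX
  rw [not_subsingleton_iff_nontrivial] at hX
  obtain ⟨η, hη⟩ := exists_finrank_weightSpace_ne_zero_of_constituents V hV hJ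
  exact hη (h η)

/-- **A weight forces a non-trivial space**: `mult V η ≠ 0 ⇒ X ≠ 0` (on a trivial space the Jacquet module, a quotient, is trivial). [folklore] -/
theorem nontrivial_of_finrank_weightSpace_ne_zero (η : (Π a : Fin n, GL {i : Fin n // (id : Fin n → Fin n) i = a} F) → ℂ)
    (h : finrank ℂ ↥(⨅ m, Module.End.maxGenEigenspace (normalizedJacquetGL F (id : Fin n → Fin n) V m) (η m)) ≠ 0) : Nontrivial X := by
  by_contra hX
  rw [not_nontrivial_iff_subsingleton] at hX
  haveI : Subsingleton (restrictUnipotentGL F (id : Fin n → Fin n) V).Coinvariants := (Representation.Coinvariants.mk_surjective _).subsingleton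
  exact h (finrank_zero_of_subsingleton)

/-- **A non-zero subrepresentation has a weight** (★ EXH on `N`, whose constituents are constituents of `V`). [cite: BernsteinZelevinsky1977, Thm. 2.9, §2.3] -/
theorem exists_finrank_weightSpace_ne_zero_of_ne_bot (hV : V.IsSmooth) [FiniteDimensional ℂ (restrictUnipotentGL F (id : Fin n → Fin n) V).Coinvariants]
    (hJ : ∀ r : SmoothIrrep (GL (Fin n) F), (IrrClass.mk r).IsConstituentOf V → Nontrivial (restrictUnipotentGL F (id : Fin n → Fin n) r.ρ).Coinvariants)
    (N : Subrepresentation V) (hN : N ≠ ⊥) :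
    ∃ η : (Π a : Fin n, GL {i : Fin n // (id : Fin n → Fin n) i = a} F) → ℂ, finrank ℂ ↥(⨅ m, Module.End.maxGenEigenspace (normalizedJacquetGL F (id : Fin n → Fin n) N.toRepresentation m) (η m)) ≠ 0 := by
  haveI : Nontrivial ↥N.toSubmodule := Submodule.nontrivial_iff_ne_bot.2 fun h => hN (Subrepresentation.toSubmodule_injective h)
  haveI : FiniteDimensional ℂ (restrictUnipotentGL F (id : Fin n → Fin n) N.toRepresentation).Coinvariants := finiteDimensional_jacquet_subrepresentation V monotone_id hV N
  exact exists_finrank_weightSpace_ne_zero_of_constituents N.toRepresentation (hV.toRepresentation N) fun r hr => hJ r (hr.of_subrepresentation N)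

end Zero

/-! ## §3 Irreducibility by exponents -/

section Irreducible

variable {F : Type} [Field F] [ValuativeRel F] [TopologicalSpace F] [IsNonarchimedeanLocalField F] {n : ℕ}
  {X : Type} [AddCommGroup X] [Module ℂ X] (V : Representation ℂ (GL (Fin n) F) X)

omit [ValuativeRel F] [TopologicalSpace F] [IsNonarchimedeanLocalField F] in
/-- `⊥ ≠ ⊤` in the lattice of subrepresentations of a representation on a non-trivial space. [folklore] -/
theorem bot_ne_top_subrepresentation [Nontrivial X] : (⊥ : Subrepresentation V) ≠ ⊤ := by
  intro h
  obtain ⟨x, hx⟩ := exists_ne (0 : X)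
  have hx' : x ∈ (⊤ : Subrepresentation V) := trivial
  rw [← h] at hx'
  exact hx ((Submodule.mem_bot ℂ).1 hx')

/-- **(I1) A SINGLE WEIGHT OF MULTIPLICITY AT MOST ONE ⇒ IRREDUCIBLE.**  If `mult V η = 0` for `η ≠ η₀` and `mult V η₀ ≤ 1` (with `hJ`, `X ≠ 0`), then `V` is irreducible: a
proper non-zero subrepresentation `N` and the quotient `V⁄N` would each carry a weight (★ EXH), necessarily `η₀`, and ★ ADD additivity would give `mult V η₀ ≥ 2`.
[cite: BernsteinZelevinsky1977, Cor. 2.13, §2.3] [cite: Casselman1995, §6.3] -/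
theorem isIrreducible_of_finrank_weightSpace_le_one [Nontrivial X] (hV : V.IsSmooth) [FiniteDimensional ℂ (restrictUnipotentGL F (id : Fin n → Fin n) V).Coinvariants]
    (hJ : ∀ r : SmoothIrrep (GL (Fin n) F), (IrrClass.mk r).IsConstituentOf V → Nontrivial (restrictUnipotentGL F (id : Fin n → Fin n) r.ρ).Coinvariants)
    (η₀ : (Π a : Fin n, GL {i : Fin n // (id : Fin n → Fin n) i = a} F) → ℂ)
    (h1 : finrank ℂ ↥(⨅ m, Module.End.maxGenEigenspace (normalizedJacquetGL F (id : Fin n → Fin n) V m) (η₀ m)) ≤ 1)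
    (h0 : ∀ η : (Π a : Fin n, GL {i : Fin n // (id : Fin n → Fin n) i = a} F) → ℂ, η ≠ η₀ →
      finrank ℂ ↥(⨅ m, Module.End.maxGenEigenspace (normalizedJacquetGL F (id : Fin n → Fin n) V m) (η m)) = 0) :
    V.IsIrreducible := by
  refine { exists_pair_ne := ⟨⊥, ⊤, bot_ne_top_subrepresentation V⟩, eq_bot_or_eq_top := fun N => ?_ }
  by_contra hN
  push Not at hN
  obtain ⟨η₁, hη₁⟩ := exists_finrank_weightSpace_ne_zero_of_ne_bot V hV hJ N hN.1
  obtain ⟨η₂, hη₂⟩ := exists_finrank_weightSpace_quotientRep_ne_zero V hV hJ N hN.2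
  have hadd₁ := finrank_weightSpace_eq_add_subrepresentation V hV N η₁
  have hadd₂ := finrank_weightSpace_eq_add_subrepresentation V hV N η₂
  have e₁ : η₁ = η₀ := by
    by_contra hne
    have := h0 η₁ hne
    omega
  have e₂ : η₂ = η₀ := by
    by_contra hne
    have := h0 η₂ hne
    omega
  subst e₁ e₂
  omega

/-- **(I2) A TWO-WEIGHT CLASS WITH SUBREPRESENTATION CONSTANCY ⇒ IRREDUCIBLE.**  If `mult V η₁ = mult V η₂ = 1`, `mult V η = 0` off `{η₁, η₂}`, and every subrepresentation
`N ≤ V` has `mult N η₁ = mult N η₂` (the CLASS is rigid — H0's swap rule applied to `N`), then `V` is irreducible: for a proper non-zero `N` the quotient `V⁄N` carries a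
weight `ηᵢ`, so `mult N ηᵢ = 0`, so `mult N η₁ = mult N η₂ = 0` and `N` has no weight at all — against ★ EXH. [cite: BernsteinZelevinsky1977, Cor. 2.13, §2.3] [cite: Zelevinsky1980, §1] -/
theorem isIrreducible_of_pair [Nontrivial X] (hV : V.IsSmooth) [FiniteDimensional ℂ (restrictUnipotentGL F (id : Fin n → Fin n) V).Coinvariants]
    (hJ : ∀ r : SmoothIrrep (GL (Fin n) F), (IrrClass.mk r).IsConstituentOf V → Nontrivial (restrictUnipotentGL F (id : Fin n → Fin n) r.ρ).Coinvariants)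
    (η₁ η₂ : (Π a : Fin n, GL {i : Fin n // (id : Fin n → Fin n) i = a} F) → ℂ)
    (h1 : finrank ℂ ↥(⨅ m, Module.End.maxGenEigenspace (normalizedJacquetGL F (id : Fin n → Fin n) V m) (η₁ m)) ≤ 1)
    (h2 : finrank ℂ ↥(⨅ m, Module.End.maxGenEigenspace (normalizedJacquetGL F (id : Fin n → Fin n) V m) (η₂ m)) ≤ 1)
    (h0 : ∀ η : (Π a : Fin n, GL {i : Fin n // (id : Fin n → Fin n) i = a} F) → ℂ, η ≠ η₁ → η ≠ η₂ →
      finrank ℂ ↥(⨅ m, Module.End.maxGenEigenspace (normalizedJacquetGL F (id : Fin n → Fin n) V m) (η m)) = 0)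
    (hconst : ∀ N : Subrepresentation V,
      finrank ℂ ↥(⨅ m, Module.End.maxGenEigenspace (normalizedJacquetGL F (id : Fin n → Fin n) N.toRepresentation m) (η₁ m)) =
        finrank ℂ ↥(⨅ m, Module.End.maxGenEigenspace (normalizedJacquetGL F (id : Fin n → Fin n) N.toRepresentation m) (η₂ m))) :
    V.IsIrreducible := by
  refine { exists_pair_ne := ⟨⊥, ⊤, bot_ne_top_subrepresentation V⟩, eq_bot_or_eq_top := fun N => ?_ }
  by_contra hN
  push Not at hN
  obtain ⟨η, hη⟩ := exists_finrank_weightSpace_ne_zero_of_ne_bot V hV hJ N hN.1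
  obtain ⟨η', hη'⟩ := exists_finrank_weightSpace_quotientRep_ne_zero V hV hJ N hN.2
  have hadd := finrank_weightSpace_eq_add_subrepresentation V hV N η
  have hadd' := finrank_weightSpace_eq_add_subrepresentation V hV N η'
  have hadd₁ := finrank_weightSpace_eq_add_subrepresentation V hV N η₁
  have hadd₂ := finrank_weightSpace_eq_add_subrepresentation V hV N η₂
  have hN12 := hconst N
  -- the weight `η` of `N` is `η₁` or `η₂`
  have hη12 : η = η₁ ∨ η = η₂ := by
    by_contra hne
    push Not at hne
    have := h0 η hne.1 hne.2
    omega
  -- the weight `η'` of `V ⁄ N` is `η₁` or `η₂`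
  have hη'12 : η' = η₁ ∨ η' = η₂ := by
    by_contra hne
    push Not at hne
    have := h0 η' hne.1 hne.2
    omega
  rcases hη12 with rfl | rfl <;> rcases hη'12 with rfl | rfl <;> omega

end Irreducible

/-! ## §4 The socle argument -/

section Socle

variable {F : Type} [Field F] [ValuativeRel F] [TopologicalSpace F] [IsNonarchimedeanLocalField F] {n : ℕ}
  {X : Type} [AddCommGroup X] [Module ℂ X] (V : Representation ℂ (GL (Fin n) F) X)

omit [ValuativeRel F] [TopologicalSpace F] [IsNonarchimedeanLocalField F] in
/-- An IRREDUCIBLE subrepresentation meets any subrepresentation trivially or lies inside it. [folklore] -/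
theorem inf_eq_bot_or_le_of_isIrreducible (N M : Subrepresentation V) [N.toRepresentation.IsIrreducible] : N ⊓ M = ⊥ ∨ N ≤ M := by
  let M' : Subrepresentation N.toRepresentation := ⟨M.toSubmodule.comap N.toSubmodule.subtype, fun g _ hx => M.apply_mem_toSubmodule g hx⟩
  rcases IsSimpleOrder.eq_bot_or_eq_top M' with hM | hM
  · refine Or.inl (le_bot_iff.1 fun v hv => ?_)
    have hvM : (⟨v, hv.1⟩ : ↥N.toSubmodule) ∈ M' := hv.2
    rw [hM] at hvM
    exact congrArg Subtype.val (show (⟨v, hv.1⟩ : ↥N.toSubmodule) = 0 from hvM)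
  · refine Or.inr fun v hv => ?_
    have hvM : (⟨v, hv⟩ : ↥N.toSubmodule) ∈ M' := by rw [hM]; trivial
    exact hvM

/-- **THE SOCLE ARGUMENT.**  If `N ≤ V` is irreducible and carries the weight `η` (`mult N η ≠ 0`), `mult V η ≤ 1`, and `M ≤ V` also carries `η`, then `N ≤ M`: otherwise
`N ⊓ M = ⊥` and ★ UNIQ ED. 2 pigeonhole `mult N η + mult M η ≤ mult V η ≤ 1`. [cite: BernsteinZelevinsky1977, Cor. 2.13, §2.3] [cite: Casselman1995, §6.3] -/
theorem le_of_isIrreducible_of_finrank_weightSpace_le_one (hV : V.IsSmooth) [FiniteDimensional ℂ (restrictUnipotentGL F (id : Fin n → Fin n) V).Coinvariants]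
    (N M : Subrepresentation V) [N.toRepresentation.IsIrreducible] (η : (Π a : Fin n, GL {i : Fin n // (id : Fin n → Fin n) i = a} F) → ℂ)
    (h1 : finrank ℂ ↥(⨅ m, Module.End.maxGenEigenspace (normalizedJacquetGL F (id : Fin n → Fin n) V m) (η m)) ≤ 1)
    (hN : finrank ℂ ↥(⨅ m, Module.End.maxGenEigenspace (normalizedJacquetGL F (id : Fin n → Fin n) N.toRepresentation m) (η m)) ≠ 0)
    (hM : finrank ℂ ↥(⨅ m, Module.End.maxGenEigenspace (normalizedJacquetGL F (id : Fin n → Fin n) M.toRepresentation m) (η m)) ≠ 0) :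
    N ≤ M := by
  rcases inf_eq_bot_or_le_of_isIrreducible V N M with hinf | hle
  · have := finrank_weightSpace_add_le_of_inf_eq_bot V hV hinf η
    omega
  · exact hle

end Socle

end Summit.HodgeConjecture.HodgeConjecture.Cruxes.H413.K2E3GL3ExponentClassTools

end
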